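import Summits.Ventures.CertifiedManyBodySolver.Upper.BlochDressedCellBoundTTPrime
import Summits.Ventures.CertifiedManyBodySolver.Upper.BlochDressedCornerHarmonicsTTPrime
import HarnessLib

/-!
# Ventures/CertifiedManyBodySolver — Upper/BlochDressedQFCertificateTTPrime.lean

HONEST FRAMING: first certified bounds; not a superconductivity verdict; every number certified or labelled float.

THE `t–t'` PLAQUETTE-DRESSED TRANSLATION-INVARIANT QUASI-FREE UPPER BOUND IN THE THERMODYNAMIC LIMIT AND THE SOUNDNESS OF A
FORMAT-qfp1 CERTIFICATE READ AT `(t', U)` (hubbard-fast-atlas-2; step F, the last file of the `t–t'` twin of the chain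
`Upper/BlochDressed*.lean`, whose `t' = 0` end is `Upper/BlochDressedQFCertificate.lean`; theorem-only, nothing is claimed).
The cell-form bound `energyDensityTT'_le_dressedCell` reads the Bloch reference through harmonics `|k|⁻¹ Σ_κ χ_κ(u) Q σ κ` with
`u ∈ {0, ±e_j}` (plaquette and axial-link windows, as at `t' = 0`) and, for the CORNER windows, `u ∈ {0, ±1}²`
(`Upper/BlochDressedCornerHarmonicsTTPrime.lean`); for a finitely supported certified kernel these are kernel entries `γ_σ(-u)`:
* `energyDensityTT'_le_dressedCell_of_harmonics`, `le_of_forall_large_torus_TT'`, **`energyDensityTT'_le_dressedCell_TL`**;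
* **`energyDensityTT'_le_qfpCellEnergyTT'`** — with EXACTLY the kernel / shrink data and reader duties of the `t' = 0` theorem
  `energyDensity2D_le_qfpCellEnergy` (the certificate is `t'`-independent) and any cell-periodic layer `v` of number-conserving
  plaquette unitaries: `e(t,t',U; re Σ_σ tr γ_σ(0)/|cell|) ≤ re 𝒞ᵗᵗ'_v(γ)/|cell|` for ALL real `t, t'` and `U ≥ 0` — an explicit
  finite expression in the kernel entries `γ_σ(u)`, `u ∈ {0,±1}²`, the gates and the tree's `slaterRDM`; since a fixed state's energy
  is affine in `(t, t', U)`, this is the cap PLANE `A + t'·B + U·D` of the hubbard-fast QFPTP layer once the three sums are read off.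
Sources: Lieb 1981 [Lieb1981]; Bach–Lieb–Solovej 1994 (2c.36), (3a.2) [BachLiebSolovej1994]. Everything proved; no definition.
-/

noncomputable section

namespace Summit.Ventures.CertifiedManyBodySolver.Upper

open Matrix Finset Filter
open Literature.MathematicalPhysics.QuantumLattice Literature.MathematicalPhysics.QuantumLattice.HartreeFock
  Literature.MathematicalPhysics.QuantumLattice.ThermodynamicLimit HeisenbergTL HubbardWave0 PlaquetteLUC
open scoped ComplexOrder ComplexConjugate Topology


/-! ### The thermodynamic limit through the harmonics, and the certificate theorem -/

section Certificate

variable {M : Fin 2 → ℕ} [∀ i, NeZero (M i)] {q : Fin 2 → ℕ}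

/-- **Cell-form `t–t'` bound read through the harmonics.** `e(t,t',U;n̄) ≤ re 𝒞ᵗᵗ'_v(Γ)/|cell| + K'_v/(2m)² + (16|t|+32|t'|)/(2m)` for every
torus `(ℤ/2m)²` carrying a Bloch reference with spectra in `[0,1]`, filling `n̄`, axial harmonics `(Γ₀, Γ₊, Γ₋)` and corner harmonics
`Γ σ u` (`u ∈ {0,±1}²`); the right-hand side depends on the reference only through the harmonics. [cite: BachLiebSolovej1994, eq. (2c.36)] -/
theorem energyDensityTT'_le_dressedCell_of_harmonics {m : ℕ} [NeZero m] {k : Fin 2 → ℕ} [∀ i, NeZero (k i)]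
    (hm : 2 ≤ m) (hkM : ∀ i, k i * M i = m * 2) (hq : ∀ i, M i = 2 * q i) (hq0 : ∀ i, 0 < q i) (t t' : ℝ) {U : ℝ} (hU : 0 ≤ U)
    (Q : Fin 2 → RectTorusSite k → Matrix (RectTorusSite M) (RectTorusSite M) ℂ) (hQh : ∀ σ κ, (Q σ κ).IsHermitian)
    (h0 : ∀ σ κ i, 0 ≤ (hQh σ κ).eigenvalues i) (h1 : ∀ σ κ i, (hQh σ κ).eigenvalues i ≤ 1) {nbar : ℝ}
    (hn : (∑ σ, ∑ κ, (Q σ κ).trace).re / ((m * 2 : ℕ) : ℝ) ^ 2 = nbar) (hn0 : 0 < nbar) (hn2 : nbar < 2)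
    (Γ₀ : Fin 2 → Matrix (RectTorusSite M) (RectTorusSite M) ℂ) (Γp Γm : Fin 2 → Fin 2 → Matrix (RectTorusSite M) (RectTorusSite M) ℂ)
    (Γ : Fin 2 → (Fin 2 → ℤ) → Matrix (RectTorusSite M) (RectTorusSite M) ℂ)
    (hΓ₀ : ∀ σ p p', ((Fintype.card (RectTorusSite k) : ℂ))⁻¹ * ∑ κ, Q σ κ p p' = Γ₀ σ p p')
    (hΓp : ∀ σ j p p', ((Fintype.card (RectTorusSite k) : ℂ))⁻¹ * ∑ κ, blockChar κ (Pi.single j 1) * Q σ κ p p' = Γp σ j p p')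
    (hΓm : ∀ σ j p p', ((Fintype.card (RectTorusSite k) : ℂ))⁻¹ * ∑ κ, blockChar κ (-Pi.single j 1) * Q σ κ p p' = Γm σ j p p')
    (hΓ : ∀ σ (u : Fin 2 → ℤ), (∀ j, u j = 0 ∨ u j = 1 ∨ u j = -1) → ∀ p p',
      ((Fintype.card (RectTorusSite k) : ℂ))⁻¹ * ∑ κ, blockChar κ (cellVec k u) * Q σ κ p p' = Γ σ u p p')
    (v : ((i : Fin 2) → Fin (q i)) → Matrix (Finset (Orb (FermionTorus 2 2))) (Finset (Orb (FermionTorus 2 2))) ℂ)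
    (hv : ∀ r, (v r)ᴴ * v r = 1) (hvN : ∀ r, Commute totalNumberOp (v r)) :
    energyDensityTT' t t' U nbar ≤
      ((∑ r : (i : Fin 2) → Fin (q i), ∑ s : Finset (Orb (FermionTorus 2 2)), ∑ s' : Finset (Orb (FermionTorus 2 2)),
              ((v r)ᴴ * (hamiltonian plaquetteGraph t U + hamiltonian plaquetteDiagGraph t' 0) * v r) s s' *
                slaterRDM (Matrix.of fun o o' : Orb (FermionTorus 2 2) => if (ofLex o).2 = (ofLex o').2 then
                  Γ₀ (ofLex o).2 (fun i => (((ofLex (ofLex o).1 i : ℕ) + 2 * (r i : ℕ) : ℕ) : ZMod (M i)))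
                    (fun i => (((ofLex (ofLex o').1 i : ℕ) + 2 * (r i : ℕ) : ℕ) : ZMod (M i))) else 0) s s') +
          ((∑ r : (i : Fin 2) → Fin (q i), ∑ j : Fin 2, ∑ s : Finset (Orb (Fin 2 ×ₗ FermionTorus 2 2)), ∑ s' : Finset (Orb (Fin 2 ×ₗ FermionTorus 2 2)),
              ((fermionEmbed inlCell (v r) * fermionEmbed inrCell
                    (v (fun i => ⟨(if i = j then (r i : ℕ) + 1 else (r i : ℕ)) % q i, Nat.mod_lt _ (hq0 i)⟩)))ᴴ *
                  (hamiltonian (linkGraph j) t 0 + hamiltonian (linkDiagGraph j) t' 0) *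
                  (fermionEmbed inlCell (v r) * fermionEmbed inrCell
                    (v (fun i => ⟨(if i = j then (r i : ℕ) + 1 else (r i : ℕ)) % q i, Nat.mod_lt _ (hq0 i)⟩)))) s s' *
                slaterRDM (Matrix.of fun o o' : Orb (Fin 2 ×ₗ FermionTorus 2 2) => if (ofLex o).2 = (ofLex o').2 then
                  (if (ofLex (ofLex o).1).1 = 0 then
                      (if (ofLex (ofLex o').1).1 = 0 then Γ₀ (ofLex o).2 else if (r j : ℕ) + 1 < q j then Γ₀ (ofLex o).2 else Γm (ofLex o).2 j)
                    else
                      (if (ofLex (ofLex o').1).1 = 0 then (if (r j : ℕ) + 1 < q j then Γ₀ (ofLex o).2 else Γp (ofLex o).2 j)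
                        else Γ₀ (ofLex o).2))
                    (fun i => (((ofLex (ofLex (ofLex o).1).2 i : ℕ) + 2 * (if (ofLex (ofLex o).1).1 = 0 then (r i : ℕ) else
                      if i = j then ((r j : ℕ) + 1) % q j else (r i : ℕ)) : ℕ) : ZMod (M i)))
                    (fun i => (((ofLex (ofLex (ofLex o').1).2 i : ℕ) + 2 * (if (ofLex (ofLex o').1).1 = 0 then (r i : ℕ) else
                      if i = j then ((r j : ℕ) + 1) % q j else (r i : ℕ)) : ℕ) : ZMod (M i))) else 0) s s') +
          (∑ r : (i : Fin 2) → Fin (q i),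
            ((∑ s : Finset (Orb (Fin 2 ×ₗ FermionTorus 2 2)), ∑ s' : Finset (Orb (Fin 2 ×ₗ FermionTorus 2 2)),
              ((fermionEmbed inlCell (v r) * fermionEmbed inrCell
                (v (fun i => ⟨((r i : ℕ) + 1) % q i, Nat.mod_lt _ (hq0 i)⟩)))ᴴ * hamiltonian (cornerGraph 0) t' 0 *
              (fermionEmbed inlCell (v r) * fermionEmbed inrCell
                (v (fun i => ⟨((r i : ℕ) + 1) % q i, Nat.mod_lt _ (hq0 i)⟩)))) s s' *
            slaterRDM (Matrix.of fun o o' : Orb (Fin 2 ×ₗ FermionTorus 2 2) => if (ofLex o).2 = (ofLex o').2 then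
              Γ (ofLex o).2 ((if (ofLex (ofLex o).1).1 = 0 then (0 : Fin 2 → ℤ) else
                    ((if (r 0 : ℕ) + 1 < q 0 then 0 else Pi.single 0 1) + (if (r 1 : ℕ) + 1 < q 1 then 0 else Pi.single 1 1))) -
                  (if (ofLex (ofLex o').1).1 = 0 then (0 : Fin 2 → ℤ) else
                    ((if (r 0 : ℕ) + 1 < q 0 then 0 else Pi.single 0 1) + (if (r 1 : ℕ) + 1 < q 1 then 0 else Pi.single 1 1))))
                  (fun i => (((ofLex (ofLex (ofLex o).1).2 i : ℕ) + 2 * (if (ofLex (ofLex o).1).1 = 0 then (r i : ℕ) else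
                    ((r i : ℕ) + 1) % q i) : ℕ) : ZMod (M i)))
                  (fun i => (((ofLex (ofLex (ofLex o').1).2 i : ℕ) + 2 * (if (ofLex (ofLex o').1).1 = 0 then (r i : ℕ) else
                    ((r i : ℕ) + 1) % q i) : ℕ) : ZMod (M i))) else 0) s s') +
            (∑ s : Finset (Orb (Fin 2 ×ₗ FermionTorus 2 2)), ∑ s' : Finset (Orb (Fin 2 ×ₗ FermionTorus 2 2)),
              ((fermionEmbed inlCell (v (fun i => ⟨(if i = 1 then (r i : ℕ) + 1 else (r i : ℕ)) % q i, Nat.mod_lt _ (hq0 i)⟩)) *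
              fermionEmbed inrCell (v (fun i => ⟨(if i = 0 then (r i : ℕ) + 1 else (r i : ℕ)) % q i, Nat.mod_lt _ (hq0 i)⟩)))ᴴ *
              hamiltonian (cornerGraph 1) t' 0 *
              (fermionEmbed inlCell (v (fun i => ⟨(if i = 1 then (r i : ℕ) + 1 else (r i : ℕ)) % q i, Nat.mod_lt _ (hq0 i)⟩)) *
                fermionEmbed inrCell (v (fun i => ⟨(if i = 0 then (r i : ℕ) + 1 else (r i : ℕ)) % q i, Nat.mod_lt _ (hq0 i)⟩)))) s s' *
            slaterRDM (Matrix.of fun o o' : Orb (Fin 2 ×ₗ FermionTorus 2 2) => if (ofLex o).2 = (ofLex o').2 then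
              Γ (ofLex o).2 ((if (ofLex (ofLex o).1).1 = 0 then (if (r 1 : ℕ) + 1 < q 1 then (0 : Fin 2 → ℤ) else Pi.single 1 1) else
                    (if (r 0 : ℕ) + 1 < q 0 then (0 : Fin 2 → ℤ) else Pi.single 0 1)) -
                  (if (ofLex (ofLex o').1).1 = 0 then (if (r 1 : ℕ) + 1 < q 1 then (0 : Fin 2 → ℤ) else Pi.single 1 1) else
                    (if (r 0 : ℕ) + 1 < q 0 then (0 : Fin 2 → ℤ) else Pi.single 0 1)))
                  (fun i => (((ofLex (ofLex (ofLex o).1).2 i : ℕ) + 2 * (if i = (if (ofLex (ofLex o).1).1 = 0 then 1 else 0) then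
                    ((r i : ℕ) + 1) % q i else (r i : ℕ)) : ℕ) : ZMod (M i)))
                  (fun i => (((ofLex (ofLex (ofLex o').1).2 i : ℕ) + 2 * (if i = (if (ofLex (ofLex o').1).1 = 0 then 1 else 0) then
                    ((r i : ℕ) + 1) % q i else (r i : ℕ)) : ℕ) : ZMod (M i))) else 0) s s'))))).re /
          ∏ i, (M i : ℝ) +
        ((∑ r : (i : Fin 2) → Fin (q i), ∑ s : Finset (Orb (FermionTorus 2 2)), ∑ s' : Finset (Orb (FermionTorus 2 2)),
              ‖((v r)ᴴ * (hamiltonian plaquetteGraph t U + hamiltonian plaquetteDiagGraph t' 0) * v r) s s'‖) *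
            (2 ^ Fintype.card (Orb (FermionTorus 2 2)) * ((Fintype.card (Orb (FermionTorus 2 2))).factorial *
              (2 * (Fintype.card (Orb (FermionTorus 2 2)) : ℝ) ^ 2))) +
          ((∑ r : (i : Fin 2) → Fin (q i), ∑ j : Fin 2,
              ∑ s : Finset (Orb (Fin 2 ×ₗ FermionTorus 2 2)), ∑ s' : Finset (Orb (Fin 2 ×ₗ FermionTorus 2 2)),
                ‖((fermionEmbed inlCell (v r) * fermionEmbed inrCell
                    (v (fun i => ⟨(if i = j then (r i : ℕ) + 1 else (r i : ℕ)) % q i, Nat.mod_lt _ (hq0 i)⟩)))ᴴ *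
                  (hamiltonian (linkGraph j) t 0 + hamiltonian (linkDiagGraph j) t' 0) *
                  (fermionEmbed inlCell (v r) * fermionEmbed inrCell
                    (v (fun i => ⟨(if i = j then (r i : ℕ) + 1 else (r i : ℕ)) % q i, Nat.mod_lt _ (hq0 i)⟩)))) s s'‖) *
            (2 ^ Fintype.card (Orb (Fin 2 ×ₗ FermionTorus 2 2)) * ((Fintype.card (Orb (Fin 2 ×ₗ FermionTorus 2 2))).factorial *
              (2 * (Fintype.card (Orb (Fin 2 ×ₗ FermionTorus 2 2)) : ℝ) ^ 2))) +
          (∑ r : (i : Fin 2) → Fin (q i),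
            ((∑ s : Finset (Orb (Fin 2 ×ₗ FermionTorus 2 2)), ∑ s' : Finset (Orb (Fin 2 ×ₗ FermionTorus 2 2)),
              ‖((fermionEmbed inlCell (v r) * fermionEmbed inrCell
                (v (fun i => ⟨((r i : ℕ) + 1) % q i, Nat.mod_lt _ (hq0 i)⟩)))ᴴ * hamiltonian (cornerGraph 0) t' 0 *
              (fermionEmbed inlCell (v r) * fermionEmbed inrCell
                (v (fun i => ⟨((r i : ℕ) + 1) % q i, Nat.mod_lt _ (hq0 i)⟩)))) s s'‖) +
            (∑ s : Finset (Orb (Fin 2 ×ₗ FermionTorus 2 2)), ∑ s' : Finset (Orb (Fin 2 ×ₗ FermionTorus 2 2)),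
              ‖((fermionEmbed inlCell (v (fun i => ⟨(if i = 1 then (r i : ℕ) + 1 else (r i : ℕ)) % q i, Nat.mod_lt _ (hq0 i)⟩)) *
              fermionEmbed inrCell (v (fun i => ⟨(if i = 0 then (r i : ℕ) + 1 else (r i : ℕ)) % q i, Nat.mod_lt _ (hq0 i)⟩)))ᴴ *
              hamiltonian (cornerGraph 1) t' 0 *
              (fermionEmbed inlCell (v (fun i => ⟨(if i = 1 then (r i : ℕ) + 1 else (r i : ℕ)) % q i, Nat.mod_lt _ (hq0 i)⟩)) *
                fermionEmbed inrCell (v (fun i => ⟨(if i = 0 then (r i : ℕ) + 1 else (r i : ℕ)) % q i, Nat.mod_lt _ (hq0 i)⟩)))) s s'‖))) *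
            (2 ^ Fintype.card (Orb (Fin 2 ×ₗ FermionTorus 2 2)) * ((Fintype.card (Orb (Fin 2 ×ₗ FermionTorus 2 2))).factorial *
              (2 * (Fintype.card (Orb (Fin 2 ×ₗ FermionTorus 2 2)) : ℝ) ^ 2))))) / ((m * 2 : ℕ) : ℝ) ^ 2 +
        (16 * |t| + 32 * |t'|) / ((m * 2 : ℕ) : ℝ) := by
  subst hn
  have h := energyDensityTT'_le_dressedCell hm hkM hq hq0 t t' hU Q hQh h0 h1 hn0 hn2 v hv hvN
  simp_rw [linkWindow_eq_harmonics Q Γ₀ Γp Γm hΓ₀ hΓp hΓm, cornerWindow_zero_eq_harmonics Q Γ hΓ,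
    cornerWindow_one_eq_harmonics Q Γ hΓ, hΓ₀] at h
  exact h

/-- **Thermodynamic limit of a bound with vanishing finite-size corrections** (`t–t'` surface constant): if for arbitrarily large `m`
one has `e ≤ C + K/(2m)² + (16|t|+32|t'|)/(2m)`, then `e ≤ C`. [folklore] -/
theorem le_of_forall_large_torus_TT' {e C K t t' : ℝ}
    (h : ∀ N : ℕ, ∃ m : ℕ, N ≤ m ∧ e ≤ C + K / ((m * 2 : ℕ) : ℝ) ^ 2 + (16 * |t| + 32 * |t'|) / ((m * 2 : ℕ) : ℝ)) : e ≤ C := by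
  choose mN hmN hle using h
  have hg : Tendsto (fun N : ℕ => ((mN N * 2 : ℕ) : ℝ)) atTop atTop := by
    refine tendsto_natCast_atTop_atTop.comp ?_
    exact Filter.tendsto_atTop_mono (fun N => by have := hmN N; show id N ≤ mN N * 2; rw [id_eq]; omega) Filter.tendsto_id
  have h1 : Tendsto (fun N : ℕ => K / ((mN N * 2 : ℕ) : ℝ) ^ 2) atTop (𝓝 0) :=
    tendsto_const_nhds.div_atTop ((tendsto_pow_atTop two_ne_zero).comp hg)
  have h2 : Tendsto (fun N : ℕ => (16 * |t| + 32 * |t'|) / ((mN N * 2 : ℕ) : ℝ)) atTop (𝓝 0) := tendsto_const_nhds.div_atTop hg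
  have hlim : Tendsto (fun N : ℕ => C + K / ((mN N * 2 : ℕ) : ℝ) ^ 2 + (16 * |t| + 32 * |t'|) / ((mN N * 2 : ℕ) : ℝ)) atTop
      (𝓝 (C + 0 + 0)) :=
    (tendsto_const_nhds.add h1).add h2
  rw [add_zero, add_zero] at hlim
  exact ge_of_tendsto' hlim fun N => hle N

/-- **The `t–t'` plaquette-dressed translation-invariant quasi-free upper bound (thermodynamic limit).** Fix an even cell `M i = 2 q i`,
a cell-periodic layer `v`, axial harmonics `(Γ₀, Γ₊, Γ₋)`, corner harmonics `Γ σ u` and a filling `n̄ ∈ (0,2)`. If tori `(ℤ/2m)²` with `m`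
arbitrarily large carry Bloch references (blocks with spectra in `[0,1]`) of filling `n̄` with these harmonics, then
`e(t,t',U;n̄) ≤ re 𝒞ᵗᵗ'_v(Γ)/|cell|`. [cite: BachLiebSolovej1994, eq. (2c.36)] -/
theorem energyDensityTT'_le_dressedCell_TL (hq : ∀ i, M i = 2 * q i) (hq0 : ∀ i, 0 < q i) (t t' : ℝ) {U : ℝ} (hU : 0 ≤ U)
    {nbar : ℝ} (hn0 : 0 < nbar) (hn2 : nbar < 2)
    (Γ₀ : Fin 2 → Matrix (RectTorusSite M) (RectTorusSite M) ℂ) (Γp Γm : Fin 2 → Fin 2 → Matrix (RectTorusSite M) (RectTorusSite M) ℂ)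
    (Γ : Fin 2 → (Fin 2 → ℤ) → Matrix (RectTorusSite M) (RectTorusSite M) ℂ)
    (v : ((i : Fin 2) → Fin (q i)) → Matrix (Finset (Orb (FermionTorus 2 2))) (Finset (Orb (FermionTorus 2 2))) ℂ)
    (hv : ∀ r, (v r)ᴴ * v r = 1) (hvN : ∀ r, Commute totalNumberOp (v r))
    (hseq : ∀ N : ℕ, ∃ (m : ℕ) (k : Fin 2 → ℕ) (_ : NeZero m) (_ : ∀ i, NeZero (k i)) (_ : 2 ≤ m) (_ : N ≤ m)
      (_ : ∀ i, k i * M i = m * 2) (Q : Fin 2 → RectTorusSite k → Matrix (RectTorusSite M) (RectTorusSite M) ℂ)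
      (hQh : ∀ σ κ, (Q σ κ).IsHermitian),
      (∀ σ κ i, 0 ≤ (hQh σ κ).eigenvalues i) ∧ (∀ σ κ i, (hQh σ κ).eigenvalues i ≤ 1) ∧
      (∑ σ, ∑ κ, (Q σ κ).trace).re / ((m * 2 : ℕ) : ℝ) ^ 2 = nbar ∧
      (∀ σ p p', ((Fintype.card (RectTorusSite k) : ℂ))⁻¹ * ∑ κ, Q σ κ p p' = Γ₀ σ p p') ∧
      (∀ σ j p p', ((Fintype.card (RectTorusSite k) : ℂ))⁻¹ * ∑ κ, blockChar κ (Pi.single j 1) * Q σ κ p p' = Γp σ j p p') ∧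
      (∀ σ j p p', ((Fintype.card (RectTorusSite k) : ℂ))⁻¹ * ∑ κ, blockChar κ (-Pi.single j 1) * Q σ κ p p' = Γm σ j p p') ∧
      (∀ σ (u : Fin 2 → ℤ), (∀ j, u j = 0 ∨ u j = 1 ∨ u j = -1) → ∀ p p',
        ((Fintype.card (RectTorusSite k) : ℂ))⁻¹ * ∑ κ, blockChar κ (cellVec k u) * Q σ κ p p' = Γ σ u p p')) :
    energyDensityTT' t t' U nbar ≤
      ((∑ r : (i : Fin 2) → Fin (q i), ∑ s : Finset (Orb (FermionTorus 2 2)), ∑ s' : Finset (Orb (FermionTorus 2 2)),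
              ((v r)ᴴ * (hamiltonian plaquetteGraph t U + hamiltonian plaquetteDiagGraph t' 0) * v r) s s' *
                slaterRDM (Matrix.of fun o o' : Orb (FermionTorus 2 2) => if (ofLex o).2 = (ofLex o').2 then
                  Γ₀ (ofLex o).2 (fun i => (((ofLex (ofLex o).1 i : ℕ) + 2 * (r i : ℕ) : ℕ) : ZMod (M i)))
                    (fun i => (((ofLex (ofLex o').1 i : ℕ) + 2 * (r i : ℕ) : ℕ) : ZMod (M i))) else 0) s s') +
          ((∑ r : (i : Fin 2) → Fin (q i), ∑ j : Fin 2, ∑ s : Finset (Orb (Fin 2 ×ₗ FermionTorus 2 2)), ∑ s' : Finset (Orb (Fin 2 ×ₗ FermionTorus 2 2)),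
              ((fermionEmbed inlCell (v r) * fermionEmbed inrCell
                    (v (fun i => ⟨(if i = j then (r i : ℕ) + 1 else (r i : ℕ)) % q i, Nat.mod_lt _ (hq0 i)⟩)))ᴴ *
                  (hamiltonian (linkGraph j) t 0 + hamiltonian (linkDiagGraph j) t' 0) *
                  (fermionEmbed inlCell (v r) * fermionEmbed inrCell
                    (v (fun i => ⟨(if i = j then (r i : ℕ) + 1 else (r i : ℕ)) % q i, Nat.mod_lt _ (hq0 i)⟩)))) s s' *
                slaterRDM (Matrix.of fun o o' : Orb (Fin 2 ×ₗ FermionTorus 2 2) => if (ofLex o).2 = (ofLex o').2 then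
                  (if (ofLex (ofLex o).1).1 = 0 then
                      (if (ofLex (ofLex o').1).1 = 0 then Γ₀ (ofLex o).2 else if (r j : ℕ) + 1 < q j then Γ₀ (ofLex o).2 else Γm (ofLex o).2 j)
                    else
                      (if (ofLex (ofLex o').1).1 = 0 then (if (r j : ℕ) + 1 < q j then Γ₀ (ofLex o).2 else Γp (ofLex o).2 j)
                        else Γ₀ (ofLex o).2))
                    (fun i => (((ofLex (ofLex (ofLex o).1).2 i : ℕ) + 2 * (if (ofLex (ofLex o).1).1 = 0 then (r i : ℕ) else
                      if i = j then ((r j : ℕ) + 1) % q j else (r i : ℕ)) : ℕ) : ZMod (M i)))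
                    (fun i => (((ofLex (ofLex (ofLex o').1).2 i : ℕ) + 2 * (if (ofLex (ofLex o').1).1 = 0 then (r i : ℕ) else
                      if i = j then ((r j : ℕ) + 1) % q j else (r i : ℕ)) : ℕ) : ZMod (M i))) else 0) s s') +
          (∑ r : (i : Fin 2) → Fin (q i),
            ((∑ s : Finset (Orb (Fin 2 ×ₗ FermionTorus 2 2)), ∑ s' : Finset (Orb (Fin 2 ×ₗ FermionTorus 2 2)),
              ((fermionEmbed inlCell (v r) * fermionEmbed inrCell
                (v (fun i => ⟨((r i : ℕ) + 1) % q i, Nat.mod_lt _ (hq0 i)⟩)))ᴴ * hamiltonian (cornerGraph 0) t' 0 *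
              (fermionEmbed inlCell (v r) * fermionEmbed inrCell
                (v (fun i => ⟨((r i : ℕ) + 1) % q i, Nat.mod_lt _ (hq0 i)⟩)))) s s' *
            slaterRDM (Matrix.of fun o o' : Orb (Fin 2 ×ₗ FermionTorus 2 2) => if (ofLex o).2 = (ofLex o').2 then
              Γ (ofLex o).2 ((if (ofLex (ofLex o).1).1 = 0 then (0 : Fin 2 → ℤ) else
                    ((if (r 0 : ℕ) + 1 < q 0 then 0 else Pi.single 0 1) + (if (r 1 : ℕ) + 1 < q 1 then 0 else Pi.single 1 1))) -
                  (if (ofLex (ofLex o').1).1 = 0 then (0 : Fin 2 → ℤ) else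
                    ((if (r 0 : ℕ) + 1 < q 0 then 0 else Pi.single 0 1) + (if (r 1 : ℕ) + 1 < q 1 then 0 else Pi.single 1 1))))
                  (fun i => (((ofLex (ofLex (ofLex o).1).2 i : ℕ) + 2 * (if (ofLex (ofLex o).1).1 = 0 then (r i : ℕ) else
                    ((r i : ℕ) + 1) % q i) : ℕ) : ZMod (M i)))
                  (fun i => (((ofLex (ofLex (ofLex o').1).2 i : ℕ) + 2 * (if (ofLex (ofLex o').1).1 = 0 then (r i : ℕ) else
                    ((r i : ℕ) + 1) % q i) : ℕ) : ZMod (M i))) else 0) s s') +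
            (∑ s : Finset (Orb (Fin 2 ×ₗ FermionTorus 2 2)), ∑ s' : Finset (Orb (Fin 2 ×ₗ FermionTorus 2 2)),
              ((fermionEmbed inlCell (v (fun i => ⟨(if i = 1 then (r i : ℕ) + 1 else (r i : ℕ)) % q i, Nat.mod_lt _ (hq0 i)⟩)) *
              fermionEmbed inrCell (v (fun i => ⟨(if i = 0 then (r i : ℕ) + 1 else (r i : ℕ)) % q i, Nat.mod_lt _ (hq0 i)⟩)))ᴴ *
              hamiltonian (cornerGraph 1) t' 0 *
              (fermionEmbed inlCell (v (fun i => ⟨(if i = 1 then (r i : ℕ) + 1 else (r i : ℕ)) % q i, Nat.mod_lt _ (hq0 i)⟩)) *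
                fermionEmbed inrCell (v (fun i => ⟨(if i = 0 then (r i : ℕ) + 1 else (r i : ℕ)) % q i, Nat.mod_lt _ (hq0 i)⟩)))) s s' *
            slaterRDM (Matrix.of fun o o' : Orb (Fin 2 ×ₗ FermionTorus 2 2) => if (ofLex o).2 = (ofLex o').2 then
              Γ (ofLex o).2 ((if (ofLex (ofLex o).1).1 = 0 then (if (r 1 : ℕ) + 1 < q 1 then (0 : Fin 2 → ℤ) else Pi.single 1 1) else
                    (if (r 0 : ℕ) + 1 < q 0 then (0 : Fin 2 → ℤ) else Pi.single 0 1)) -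
                  (if (ofLex (ofLex o').1).1 = 0 then (if (r 1 : ℕ) + 1 < q 1 then (0 : Fin 2 → ℤ) else Pi.single 1 1) else
                    (if (r 0 : ℕ) + 1 < q 0 then (0 : Fin 2 → ℤ) else Pi.single 0 1)))
                  (fun i => (((ofLex (ofLex (ofLex o).1).2 i : ℕ) + 2 * (if i = (if (ofLex (ofLex o).1).1 = 0 then 1 else 0) then
                    ((r i : ℕ) + 1) % q i else (r i : ℕ)) : ℕ) : ZMod (M i)))
                  (fun i => (((ofLex (ofLex (ofLex o').1).2 i : ℕ) + 2 * (if i = (if (ofLex (ofLex o').1).1 = 0 then 1 else 0) then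
                    ((r i : ℕ) + 1) % q i else (r i : ℕ)) : ℕ) : ZMod (M i))) else 0) s s'))))).re /
          ∏ i, (M i : ℝ) := by
  refine le_of_forall_large_torus_TT' (t := t) (t' := t')
    (K := ((∑ r : (i : Fin 2) → Fin (q i), ∑ s : Finset (Orb (FermionTorus 2 2)), ∑ s' : Finset (Orb (FermionTorus 2 2)),
              ‖((v r)ᴴ * (hamiltonian plaquetteGraph t U + hamiltonian plaquetteDiagGraph t' 0) * v r) s s'‖) *
            (2 ^ Fintype.card (Orb (FermionTorus 2 2)) * ((Fintype.card (Orb (FermionTorus 2 2))).factorial *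
              (2 * (Fintype.card (Orb (FermionTorus 2 2)) : ℝ) ^ 2))) +
          ((∑ r : (i : Fin 2) → Fin (q i), ∑ j : Fin 2,
              ∑ s : Finset (Orb (Fin 2 ×ₗ FermionTorus 2 2)), ∑ s' : Finset (Orb (Fin 2 ×ₗ FermionTorus 2 2)),
                ‖((fermionEmbed inlCell (v r) * fermionEmbed inrCell
                    (v (fun i => ⟨(if i = j then (r i : ℕ) + 1 else (r i : ℕ)) % q i, Nat.mod_lt _ (hq0 i)⟩)))ᴴ *
                  (hamiltonian (linkGraph j) t 0 + hamiltonian (linkDiagGraph j) t' 0) *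
                  (fermionEmbed inlCell (v r) * fermionEmbed inrCell
                    (v (fun i => ⟨(if i = j then (r i : ℕ) + 1 else (r i : ℕ)) % q i, Nat.mod_lt _ (hq0 i)⟩)))) s s'‖) *
            (2 ^ Fintype.card (Orb (Fin 2 ×ₗ FermionTorus 2 2)) * ((Fintype.card (Orb (Fin 2 ×ₗ FermionTorus 2 2))).factorial *
              (2 * (Fintype.card (Orb (Fin 2 ×ₗ FermionTorus 2 2)) : ℝ) ^ 2))) +
          (∑ r : (i : Fin 2) → Fin (q i),
            ((∑ s : Finset (Orb (Fin 2 ×ₗ FermionTorus 2 2)), ∑ s' : Finset (Orb (Fin 2 ×ₗ FermionTorus 2 2)),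
              ‖((fermionEmbed inlCell (v r) * fermionEmbed inrCell
                (v (fun i => ⟨((r i : ℕ) + 1) % q i, Nat.mod_lt _ (hq0 i)⟩)))ᴴ * hamiltonian (cornerGraph 0) t' 0 *
              (fermionEmbed inlCell (v r) * fermionEmbed inrCell
                (v (fun i => ⟨((r i : ℕ) + 1) % q i, Nat.mod_lt _ (hq0 i)⟩)))) s s'‖) +
            (∑ s : Finset (Orb (Fin 2 ×ₗ FermionTorus 2 2)), ∑ s' : Finset (Orb (Fin 2 ×ₗ FermionTorus 2 2)),
              ‖((fermionEmbed inlCell (v (fun i => ⟨(if i = 1 then (r i : ℕ) + 1 else (r i : ℕ)) % q i, Nat.mod_lt _ (hq0 i)⟩)) *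
              fermionEmbed inrCell (v (fun i => ⟨(if i = 0 then (r i : ℕ) + 1 else (r i : ℕ)) % q i, Nat.mod_lt _ (hq0 i)⟩)))ᴴ *
              hamiltonian (cornerGraph 1) t' 0 *
              (fermionEmbed inlCell (v (fun i => ⟨(if i = 1 then (r i : ℕ) + 1 else (r i : ℕ)) % q i, Nat.mod_lt _ (hq0 i)⟩)) *
                fermionEmbed inrCell (v (fun i => ⟨(if i = 0 then (r i : ℕ) + 1 else (r i : ℕ)) % q i, Nat.mod_lt _ (hq0 i)⟩)))) s s'‖))) *
            (2 ^ Fintype.card (Orb (Fin 2 ×ₗ FermionTorus 2 2)) * ((Fintype.card (Orb (Fin 2 ×ₗ FermionTorus 2 2))).factorial *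
              (2 * (Fintype.card (Orb (Fin 2 ×ₗ FermionTorus 2 2)) : ℝ) ^ 2)))))) fun N => ?_
  obtain ⟨m, k, hmz, hkz, hm, hNm, hkM, Q, hQh, h0, h1, hn, hΓ₀, hΓp, hΓm, hΓ⟩ := hseq N
  exact ⟨m, hNm, energyDensityTT'_le_dressedCell_of_harmonics hm hkM hq hq0 t t' hU Q hQh h0 h1 hn hn0 hn2 Γ₀ Γp Γm Γ hΓ₀ hΓp hΓm hΓ
    v hv hvN⟩

/-- **Soundness of a plaquette-dressed translation-invariant quasi-free certificate (FORMAT-qfp1) READ AT `(t, t', U)`.** Even cell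
`M i = 2 q i`; base cell counts `k₀ i ≥ Rc i + 2` with `k₀ i · M i = 2 m₀`; kernel data and reader duties EXACTLY as in the `t' = 0` theorem
`energyDensity2D_le_qfpCellEnergy` (support `S` of radius `Rc`, symmetric, `0 ∈ S`; pre-shrink kernels `γ̃_σ` vanishing outside `S` with
`γ̃_σ(-R) = γ̃_σ(R)ᴴ`; Frobenius bounds `c_σ(T)` of the defect kernel; shrink parameters `a_σ ≥ 0`, `a_σ Σ c_σ ≤ b_σ`, `a_σ(1 + Σ c_σ) + b_σ ≤ 1`;
density in `(0,2)`), and any cell-periodic layer `v` of number-conserving plaquette unitaries. Then, with the shrunk kernel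
`γ_σ = a_σ γ̃_σ + b_σ δ_{R,0} 1`, for ALL real `t, t'` and `U ≥ 0`:
`e(t,t',U; re Σ_σ tr γ_σ(0) / |cell|) ≤ re 𝒞ᵗᵗ'_v(γ) / |cell|` — the `t–t'` dressed cell energy on the kernel entries (axial harmonics
`γ_σ(0)`, `γ_σ(∓e_j)`, corner harmonics `γ_σ(-u)`, `u ∈ {0,±1}²`). [cite: BachLiebSolovej1994, eq. (2c.36)] -/
theorem energyDensityTT'_le_qfpCellEnergyTT' (hq : ∀ i, M i = 2 * q i) (hq0 : ∀ i, 0 < q i)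
    (k₀ : Fin 2 → ℕ) (m₀ : ℕ) (hk₀ : ∀ i, k₀ i * M i = m₀ * 2) (t t' : ℝ) {U : ℝ} (hU : 0 ≤ U)
    (S : Finset (Fin 2 → ℤ)) (Rc : Fin 2 → ℕ) (hRc : ∀ R ∈ S, ∀ i, |R i| ≤ Rc i) (hkRc : ∀ i, Rc i + 2 ≤ k₀ i)
    (h0S : (0 : Fin 2 → ℤ) ∈ S) (hSneg : ∀ R ∈ S, -R ∈ S)
    (γt : Fin 2 → (Fin 2 → ℤ) → Matrix (RectTorusSite M) (RectTorusSite M) ℂ)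
    (hγtS : ∀ σ, ∀ R ∉ S, γt σ R = 0) (hγt : ∀ σ R, γt σ (-R) = (γt σ R)ᴴ)
    (c : Fin 2 → (Fin 2 → ℤ) → ℝ)
    (hc : ∀ σ, ∀ T ∈ defectSupport S, Real.sqrt (∑ i, ∑ j, ‖defectKernel S (γt σ) T i j‖ ^ 2) ≤ c σ T)
    (a b : Fin 2 → ℝ) (ha : ∀ σ, 0 ≤ a σ) (hab : ∀ σ, a σ * (∑ T ∈ defectSupport S, c σ T) ≤ b σ)
    (hab1 : ∀ σ, a σ * (1 + ∑ T ∈ defectSupport S, c σ T) + b σ ≤ 1)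
    (hn0 : 0 < (∑ σ, (shrinkKernel (γt σ) (a σ) (b σ) 0).trace).re / ∏ i, (M i : ℝ))
    (hn2 : (∑ σ, (shrinkKernel (γt σ) (a σ) (b σ) 0).trace).re / ∏ i, (M i : ℝ) < 2)
    (v : ((i : Fin 2) → Fin (q i)) → Matrix (Finset (Orb (FermionTorus 2 2))) (Finset (Orb (FermionTorus 2 2))) ℂ)
    (hv : ∀ r, (v r)ᴴ * v r = 1) (hvN : ∀ r, Commute totalNumberOp (v r)) :
    energyDensityTT' t t' U ((∑ σ, (shrinkKernel (γt σ) (a σ) (b σ) 0).trace).re / ∏ i, (M i : ℝ)) ≤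
      ((∑ r : (i : Fin 2) → Fin (q i), ∑ s : Finset (Orb (FermionTorus 2 2)), ∑ s' : Finset (Orb (FermionTorus 2 2)),
              ((v r)ᴴ * (hamiltonian plaquetteGraph t U + hamiltonian plaquetteDiagGraph t' 0) * v r) s s' *
                slaterRDM (Matrix.of fun o o' : Orb (FermionTorus 2 2) => if (ofLex o).2 = (ofLex o').2 then
                  shrinkKernel (γt (ofLex o).2) (a (ofLex o).2) (b (ofLex o).2) 0 (fun i => (((ofLex (ofLex o).1 i : ℕ) + 2 * (r i : ℕ) : ℕ) : ZMod (M i)))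
                    (fun i => (((ofLex (ofLex o').1 i : ℕ) + 2 * (r i : ℕ) : ℕ) : ZMod (M i))) else 0) s s') +
          ((∑ r : (i : Fin 2) → Fin (q i), ∑ j : Fin 2, ∑ s : Finset (Orb (Fin 2 ×ₗ FermionTorus 2 2)), ∑ s' : Finset (Orb (Fin 2 ×ₗ FermionTorus 2 2)),
              ((fermionEmbed inlCell (v r) * fermionEmbed inrCell
                    (v (fun i => ⟨(if i = j then (r i : ℕ) + 1 else (r i : ℕ)) % q i, Nat.mod_lt _ (hq0 i)⟩)))ᴴ *
                  (hamiltonian (linkGraph j) t 0 + hamiltonian (linkDiagGraph j) t' 0) *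
                  (fermionEmbed inlCell (v r) * fermionEmbed inrCell
                    (v (fun i => ⟨(if i = j then (r i : ℕ) + 1 else (r i : ℕ)) % q i, Nat.mod_lt _ (hq0 i)⟩)))) s s' *
                slaterRDM (Matrix.of fun o o' : Orb (Fin 2 ×ₗ FermionTorus 2 2) => if (ofLex o).2 = (ofLex o').2 then
                  (if (ofLex (ofLex o).1).1 = 0 then
                      (if (ofLex (ofLex o').1).1 = 0 then shrinkKernel (γt (ofLex o).2) (a (ofLex o).2) (b (ofLex o).2) 0 else if (r j : ℕ) + 1 < q j then shrinkKernel (γt (ofLex o).2) (a (ofLex o).2) (b (ofLex o).2) 0 else shrinkKernel (γt (ofLex o).2) (a (ofLex o).2) (b (ofLex o).2) (Pi.single j 1))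
                    else
                      (if (ofLex (ofLex o').1).1 = 0 then (if (r j : ℕ) + 1 < q j then shrinkKernel (γt (ofLex o).2) (a (ofLex o).2) (b (ofLex o).2) 0 else shrinkKernel (γt (ofLex o).2) (a (ofLex o).2) (b (ofLex o).2) (-Pi.single j 1))
                        else shrinkKernel (γt (ofLex o).2) (a (ofLex o).2) (b (ofLex o).2) 0))
                    (fun i => (((ofLex (ofLex (ofLex o).1).2 i : ℕ) + 2 * (if (ofLex (ofLex o).1).1 = 0 then (r i : ℕ) else
                      if i = j then ((r j : ℕ) + 1) % q j else (r i : ℕ)) : ℕ) : ZMod (M i)))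
                    (fun i => (((ofLex (ofLex (ofLex o').1).2 i : ℕ) + 2 * (if (ofLex (ofLex o').1).1 = 0 then (r i : ℕ) else
                      if i = j then ((r j : ℕ) + 1) % q j else (r i : ℕ)) : ℕ) : ZMod (M i))) else 0) s s') +
          (∑ r : (i : Fin 2) → Fin (q i),
            ((∑ s : Finset (Orb (Fin 2 ×ₗ FermionTorus 2 2)), ∑ s' : Finset (Orb (Fin 2 ×ₗ FermionTorus 2 2)),
              ((fermionEmbed inlCell (v r) * fermionEmbed inrCell
                (v (fun i => ⟨((r i : ℕ) + 1) % q i, Nat.mod_lt _ (hq0 i)⟩)))ᴴ * hamiltonian (cornerGraph 0) t' 0 *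
              (fermionEmbed inlCell (v r) * fermionEmbed inrCell
                (v (fun i => ⟨((r i : ℕ) + 1) % q i, Nat.mod_lt _ (hq0 i)⟩)))) s s' *
            slaterRDM (Matrix.of fun o o' : Orb (Fin 2 ×ₗ FermionTorus 2 2) => if (ofLex o).2 = (ofLex o').2 then
              (fun u : Fin 2 → ℤ => shrinkKernel (γt (ofLex o).2) (a (ofLex o).2) (b (ofLex o).2) (-u)) ((if (ofLex (ofLex o).1).1 = 0 then (0 : Fin 2 → ℤ) else
                    ((if (r 0 : ℕ) + 1 < q 0 then 0 else Pi.single 0 1) + (if (r 1 : ℕ) + 1 < q 1 then 0 else Pi.single 1 1))) -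
                  (if (ofLex (ofLex o').1).1 = 0 then (0 : Fin 2 → ℤ) else
                    ((if (r 0 : ℕ) + 1 < q 0 then 0 else Pi.single 0 1) + (if (r 1 : ℕ) + 1 < q 1 then 0 else Pi.single 1 1))))
                  (fun i => (((ofLex (ofLex (ofLex o).1).2 i : ℕ) + 2 * (if (ofLex (ofLex o).1).1 = 0 then (r i : ℕ) else
                    ((r i : ℕ) + 1) % q i) : ℕ) : ZMod (M i)))
                  (fun i => (((ofLex (ofLex (ofLex o').1).2 i : ℕ) + 2 * (if (ofLex (ofLex o').1).1 = 0 then (r i : ℕ) else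
                    ((r i : ℕ) + 1) % q i) : ℕ) : ZMod (M i))) else 0) s s') +
            (∑ s : Finset (Orb (Fin 2 ×ₗ FermionTorus 2 2)), ∑ s' : Finset (Orb (Fin 2 ×ₗ FermionTorus 2 2)),
              ((fermionEmbed inlCell (v (fun i => ⟨(if i = 1 then (r i : ℕ) + 1 else (r i : ℕ)) % q i, Nat.mod_lt _ (hq0 i)⟩)) *
              fermionEmbed inrCell (v (fun i => ⟨(if i = 0 then (r i : ℕ) + 1 else (r i : ℕ)) % q i, Nat.mod_lt _ (hq0 i)⟩)))ᴴ *
              hamiltonian (cornerGraph 1) t' 0 *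
              (fermionEmbed inlCell (v (fun i => ⟨(if i = 1 then (r i : ℕ) + 1 else (r i : ℕ)) % q i, Nat.mod_lt _ (hq0 i)⟩)) *
                fermionEmbed inrCell (v (fun i => ⟨(if i = 0 then (r i : ℕ) + 1 else (r i : ℕ)) % q i, Nat.mod_lt _ (hq0 i)⟩)))) s s' *
            slaterRDM (Matrix.of fun o o' : Orb (Fin 2 ×ₗ FermionTorus 2 2) => if (ofLex o).2 = (ofLex o').2 then
              (fun u : Fin 2 → ℤ => shrinkKernel (γt (ofLex o).2) (a (ofLex o).2) (b (ofLex o).2) (-u)) ((if (ofLex (ofLex o).1).1 = 0 then (if (r 1 : ℕ) + 1 < q 1 then (0 : Fin 2 → ℤ) else Pi.single 1 1) else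
                    (if (r 0 : ℕ) + 1 < q 0 then (0 : Fin 2 → ℤ) else Pi.single 0 1)) -
                  (if (ofLex (ofLex o').1).1 = 0 then (if (r 1 : ℕ) + 1 < q 1 then (0 : Fin 2 → ℤ) else Pi.single 1 1) else
                    (if (r 0 : ℕ) + 1 < q 0 then (0 : Fin 2 → ℤ) else Pi.single 0 1)))
                  (fun i => (((ofLex (ofLex (ofLex o).1).2 i : ℕ) + 2 * (if i = (if (ofLex (ofLex o).1).1 = 0 then 1 else 0) then
                    ((r i : ℕ) + 1) % q i else (r i : ℕ)) : ℕ) : ZMod (M i)))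
                  (fun i => (((ofLex (ofLex (ofLex o').1).2 i : ℕ) + 2 * (if i = (if (ofLex (ofLex o').1).1 = 0 then 1 else 0) then
                    ((r i : ℕ) + 1) % q i else (r i : ℕ)) : ℕ) : ZMod (M i))) else 0) s s'))))).re /
          ∏ i, (M i : ℝ) := by
  refine energyDensityTT'_le_dressedCell_TL hq hq0 t t' hU hn0 hn2 (fun σ => shrinkKernel (γt σ) (a σ) (b σ) 0)
    (fun σ j => shrinkKernel (γt σ) (a σ) (b σ) (-Pi.single j 1)) (fun σ j => shrinkKernel (γt σ) (a σ) (b σ) (Pi.single j 1))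
    (fun σ u => shrinkKernel (γt σ) (a σ) (b σ) (-u)) v hv hvN fun N => ?_
  -- the torus with `(N + 1) · k₀` cells in each direction
  have hk₀pos : ∀ i, 0 < k₀ i := fun i => by have := hkRc i; omega
  have hm₀ : 2 ≤ m₀ := by
    have h1 := hk₀ 0
    have h2 : 2 ≤ k₀ 0 := by have := hkRc 0; omega
    have hM0 : 2 ≤ M 0 := by rw [hq 0]; have := hq0 0; omega
    nlinarith
  haveI hmz : NeZero ((N + 1) * m₀) := ⟨Nat.mul_ne_zero (Nat.succ_ne_zero N) (by omega)⟩
  haveI hkz : ∀ i, NeZero ((N + 1) * k₀ i) := fun i => ⟨Nat.mul_ne_zero (Nat.succ_ne_zero N) (hk₀pos i).ne'⟩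
  have hkM : ∀ i, (N + 1) * k₀ i * M i = (N + 1) * m₀ * 2 := fun i => by rw [mul_assoc, hk₀ i, mul_assoc]
  have hS : NoAlias (fun i => (N + 1) * k₀ i) S :=
    noAlias_of_radius' hRc fun i => le_trans (hkRc i) (Nat.le_mul_of_pos_left (k₀ i) (Nat.succ_pos N))
  have hγS : ∀ σ, ∀ R ∉ S, shrinkKernel (γt σ) (a σ) (b σ) R = 0 := fun σ =>
    shrinkKernel_eq_zero S (γt σ) h0S (hγtS σ) (a σ) (b σ)
  have hQ01 : ∀ σ (κ : RectTorusSite (fun i => (N + 1) * k₀ i)),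
      (kernelBlock S (shrinkKernel (γt σ) (a σ) (b σ)) κ).PosSemidef ∧ (1 - kernelBlock S (shrinkKernel (γt σ) (a σ) (b σ)) κ).PosSemidef :=
    fun σ κ => kernelBlock_shrinkKernel_posSemidef S (γt σ) h0S hSneg (hγt σ) (c σ) (hc σ) (ha σ) (hab σ) (hab1 σ) κ
  refine ⟨(N + 1) * m₀, fun i => (N + 1) * k₀ i, hmz, hkz, le_trans hm₀ (Nat.le_mul_of_pos_left m₀ (Nat.succ_pos N)),
    le_trans (Nat.le_succ N) (Nat.le_mul_of_pos_right (N + 1) (by omega)), hkM,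
    fun σ κ => kernelBlock S (shrinkKernel (γt σ) (a σ) (b σ)) κ, fun σ κ => (hQ01 σ κ).1.isHermitian,
    fun σ κ i => eigenvalues_nonneg_of_loewner _ (hQ01 σ κ).1 i, fun σ κ i => eigenvalues_le_one_of_loewner _ (hQ01 σ κ).2 i,
    ?_, ?_, ?_, ?_, ?_⟩
  · -- the filling
    have htr : ∑ σ, ∑ κ : RectTorusSite (fun i => (N + 1) * k₀ i), (kernelBlock S (shrinkKernel (γt σ) (a σ) (b σ)) κ).trace =
        (Fintype.card (RectTorusSite (fun i => (N + 1) * k₀ i)) : ℂ) * ∑ σ, (shrinkKernel (γt σ) (a σ) (b σ) 0).trace := by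
      rw [Finset.mul_sum]
      exact Finset.sum_congr rfl fun σ _ => sum_trace_kernelBlock S _ hS (hγS σ)
    rw [htr, ← card_cells_mul_prod_side hkM,
      show ((Fintype.card (RectTorusSite (fun i => (N + 1) * k₀ i)) : ℂ)) =
        (((Fintype.card (RectTorusSite (fun i => (N + 1) * k₀ i)) : ℝ)) : ℂ) by norm_cast, Complex.re_ofReal_mul]
    have hK : (0 : ℝ) < (Fintype.card (RectTorusSite (fun i => (N + 1) * k₀ i)) : ℝ) := by exact_mod_cast Fintype.card_pos
    field_simp
  · intro σ p p'
    have h := harmonic_kernelBlock hS (shrinkKernel (γt σ) (a σ) (b σ)) (hγS σ) 0 (fun j => Or.inl rfl) p p'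
    simpa only [neg_zero, show cellVec (fun i => (N + 1) * k₀ i) (0 : Fin 2 → ℤ) = 0 by funext i; simp [cellVec],
      blockChar_zero_right, one_mul] using h
  · intro σ j p p'
    have h := harmonic_kernelBlock hS (shrinkKernel (γt σ) (a σ) (b σ)) (hγS σ) (Pi.single j 1)
      (fun i => by by_cases hij : i = j <;> simp [hij]) p p'
    simpa only [cellVec_single'] using h
  · intro σ j p p'
    have h := harmonic_kernelBlock hS (shrinkKernel (γt σ) (a σ) (b σ)) (hγS σ) (-Pi.single j 1)
      (fun i => by by_cases hij : i = j <;> simp [hij]) p p'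
    simpa only [cellVec_neg_single', neg_neg] using h
  · intro σ u hu p p'
    exact harmonic_kernelBlock hS (shrinkKernel (γt σ) (a σ) (b σ)) (hγS σ) u hu p p'

end Certificate

end Summit.Ventures.CertifiedManyBodySolver.Upper
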